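import Summits.CriticalPhenomena.PercolationContinuityZ3.Theorems.PercNearOneGluingNoHeavyLowerTailSahiGridPatternTwoOrthantPairSum
import Summits.CriticalPhenomena.PercolationContinuityZ3.Theorems.PercNearOneGluingNoHeavyLowerTailSahiGridPatternTwoOrthantLHS
import Summits.CriticalPhenomena.PercolationContinuityZ3.Theorems.PercNearOneGluingNoHeavyLowerTailSahiGridPatternTwoOrthantFamilies

/-!
# `NoHeavyLowerTail` (crux stmt-CriticalPhenomena-4575), Sahi programme P1: **THE TWO-ORTHANT THEOREM** — every union of two
# orthants with disjoint supports, one of which has a threshold-2 axis, is a good slot of the pattern functional in EVERY dimension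

Support file (Sahi cell, seat `prim-sahi-p1`, generation 21; `--supports stmt-CriticalPhenomena-4575`).  Pure proofs, no definitions,
no `sorry`, standard axioms.  Setting of `…SahiGridPatternPairCert`: `[3]^{n+k} = [3]^n × [3]^k` (`glue ξ q`), `X = ↑a × [3]^k`
(`a ∈ [3]^n`, trace `XI = ↑a`), `Y = [3]^n × ↑b` (`b ∈ [3]^k`, trace `YJ = ↑b`), `U = X ∪ Y` — a union of two orthants with disjoint supports.

THE MATHEMATICS.  Hypothesis `hS` of `sStarD_cylSet_pairCert_nonneg_of_sStarD_ge` (condition (N) of the pair certificate, the open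
inequality (★₁) of generations 20) is PROVED for every `n, k`, every `b`, and every `a` having a coordinate equal to `2`, by the
TWO-ORTHANT IDENTITY (seat memo `FROM-prim-sahi-p1-gen21-TWO-ORTHANT-THEOREM.md`):
  `sStarD (X∪Y) A A' − Φ(A∩A') = Σ_{s∈XI,u∉XI,s δ̸ u}[H_k(A_s, A'_u∩YJ) + H_k(A'_s, A_u∩YJ)] + Σ_{s∈XI} ν̄(s) K_k(ȲJ; A_s, A'_s)
     + Σ_{s∈XI} ν_X(s) H_k(A_s,A'_s) + Σ_{u,v∉XI, u δ̸ v} G_k(YJ; A_u, A'_v) + Σ_{(t,t',t'') Latin} [Y(t)Q_D + Ȳ(t'')Q_E + (2−Y(t''))Q_X]`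
(sections `A_s ⊆ [3]^k`, fibres `A^t ⊆ [3]^n`; `H` coefficientwise Harris, `K` fibre Kleitman, `G_k(YJ;·,·) ≥ 0` Conjecture P for the
orthant `YJ`; for `a` with a coordinate `2`: `Q_X = 0`, `Q_D` = coefficientwise Harris of the fibres, `Q_E = G_n(XI;A^t,A'^{t'})` =
Conjecture P for the orthant `XI`).  PROOF IN LEAN: both sides are two-block pair sums `Σ[ξ δ̸ η][q δ̸ r]·kernel`
(`sStarD_union_sub_pairCertSlack_eq_pairSum`); after symmetrising over the `S₃ × S₃` relabellings of the two Latin triples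
(`ps_symI6`, `ps_symJ6`) the kernels agree IDENTICALLY (`ring`, using that a Latin triple of the free block is not inside `↑a`), and every
family is nonnegative by the kernel forms of `…TwoOrthantFamilies`.  CONSEQUENCE (`sStarD_cylSet_twoOrthant_nonneg_of_two`): for every `m`,
all up-sets `B, C ⊆ [3]^{m+(n+k)}`: `0 ≤ sStarD ((↑a × [3]^k ∪ [3]^n × ↑b) × [3]^m) B C` — with the block symmetry, EVERY union of two orthants
with disjoint supports one of which has a threshold-2 axis is a good slot in every dimension (value level, via `latticeE3_symm`: Kahn's
`E₃ ≥ 0` when one event is an OR of two ANDs on disjoint variables, for the corresponding threshold patterns).  The remaining case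
`a ∈ {1}^n, b ∈ {1}^k` needs the chart forms of `Q_D, Q_X, Q_E` (memo §0, Theorem 2) and is not asserted here.  Nothing here asserts
`PatternPos d` for `d ≥ 4`. [this work]
-/

namespace Summit.CriticalPhenomena.PercolationContinuityZ3.Theorems.SahiGridPattern

open Finset SahiGrid3
open scoped BigOperators

variable {n k : ℕ}

/-! ### Small facts about orthants and Latin triples -/

/-- Values on `Fin 3` (bookkeeping). [this work] -/
theorem fin3_latin_zero : ∀ u v : Fin 3, u ≠ v → (u = 0 ∨ v = 0 ∨ -(u + v) = 0) := by decide

/-- A Latin triple of `[3]^n` is never inside a proper orthant `↑a` (`a ≠ 0`): one of its points has indicator `0`. [this work] -/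
theorem ind_orthant_latin_zero (a : Pd n) (ha : ∃ i, a i ≠ 0) {ξ η : Pd n} (hτ : TotDist ξ η = true) :
    ind (univ.filter fun x : Pd n => ∀ i, a i ≤ x i) ξ = 0 ∨ ind (univ.filter fun x : Pd n => ∀ i, a i ≤ x i) η = 0
      ∨ ind (univ.filter fun x : Pd n => ∀ i, a i ≤ x i) (thirdPt ξ η) = 0 := by
  obtain ⟨i, hi⟩ := ha
  have hle : ∀ u : Fin 3, u ≠ 0 → ¬ u ≤ 0 := by decide
  have out : ∀ x : Pd n, x i = 0 → ind (univ.filter fun x : Pd n => ∀ i, a i ≤ x i) x = 0 := by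
    intro x hx
    unfold ind
    rw [if_neg]
    simp only [Finset.mem_filter, Finset.mem_univ, true_and, not_forall]
    exact ⟨i, by rw [hx]; exact hle _ hi⟩
  have hd : ξ i ≠ η i := (totDist_iff.1 hτ) i
  rcases fin3_latin_zero _ _ hd with h | h | h
  · exact Or.inl (out ξ h)
  · exact Or.inr (Or.inl (out η h))
  · exact Or.inr (Or.inr (out (thirdPt ξ η) h))

/-- Two totally distinct points are never both in an orthant with a threshold-2 axis. [this work] -/
theorem ind_orthant_mul_eq_zero_of_two (a : Pd n) (ha : ∃ i, a i = 2) {ξ η : Pd n} (hτ : TotDist ξ η = true) :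
    ind (univ.filter fun x : Pd n => ∀ i, a i ≤ x i) ξ * ind (univ.filter fun x : Pd n => ∀ i, a i ≤ x i) η = 0 := by
  obtain ⟨i, hi⟩ := ha
  have htwo : ∀ u : Fin 3, 2 ≤ u → u = 2 := by decide
  unfold ind
  by_cases hξ : ξ ∈ (univ.filter fun x : Pd n => ∀ i, a i ≤ x i)
  · by_cases hη : η ∈ (univ.filter fun x : Pd n => ∀ i, a i ≤ x i)
    · exfalso
      simp only [Finset.mem_filter, Finset.mem_univ, true_and] at hξ hη
      have h1 := htwo _ (hi ▸ hξ i)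
      have h2 := htwo _ (hi ▸ hη i)
      exact (totDist_iff.1 hτ) i (h1.trans h2.symm)
    · rw [if_neg hη]; ring
  · rw [if_neg hξ]; ring

/-- The same for a point and the third point of a Latin triple through it. [this work] -/
theorem ind_orthant_mul_third_eq_zero_of_two (a : Pd n) (ha : ∃ i, a i = 2) {ξ η : Pd n} (hτ : TotDist ξ η = true) :
    ind (univ.filter fun x : Pd n => ∀ i, a i ≤ x i) ξ * ind (univ.filter fun x : Pd n => ∀ i, a i ≤ x i) (thirdPt ξ η) = 0 :=
  ind_orthant_mul_eq_zero_of_two a ha ((totDist_thirdPt_iff ξ η).2 hτ)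

/-! ### Outer/inner splitting of a two-block pair sum -/

/-- A pair sum whose kernel is `c(ξ,η)·g` with `c ≥ 0` and fibrewise nonnegative inner cell-block sums is nonnegative. [this work] -/
theorem ps_nonneg_of_innerJ (c : Pd n → Pd n → ℤ) (g : Pd n → Pd n → Pd k → Pd k → Pd k → ℤ)
    (hc : ∀ ξ η, 0 ≤ c ξ η)
    (hg : ∀ ξ η, TotDist ξ η = true → 0 ≤ ∑ q : Pd k, ∑ r : Pd k, (if TotDist q r = true then (1:ℤ) else 0) * g ξ η q r (thirdPt q r)) :
    0 ≤ ∑ ξ : Pd n, ∑ η : Pd n, ∑ q : Pd k, ∑ r : Pd k,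
      (if TotDist ξ η = true then (1:ℤ) else 0) * (if TotDist q r = true then (1:ℤ) else 0) * (c ξ η * g ξ η q r (thirdPt q r)) := by
  refine Finset.sum_nonneg fun ξ _ => Finset.sum_nonneg fun η _ => ?_
  have e : (∑ q : Pd k, ∑ r : Pd k, (if TotDist ξ η = true then (1:ℤ) else 0) * (if TotDist q r = true then (1:ℤ) else 0) * (c ξ η * g ξ η q r (thirdPt q r)))
      = ((if TotDist ξ η = true then (1:ℤ) else 0) * c ξ η) * ∑ q : Pd k, ∑ r : Pd k, (if TotDist q r = true then (1:ℤ) else 0) * g ξ η q r (thirdPt q r) := by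
    rw [Finset.mul_sum]
    refine Finset.sum_congr rfl fun q _ => ?_
    rw [Finset.mul_sum]
    refine Finset.sum_congr rfl fun r _ => ?_
    ring
  rw [e]
  by_cases hτ : TotDist ξ η = true
  · rw [if_pos hτ, one_mul]; exact mul_nonneg (hc ξ η) (hg ξ η hτ)
  · rw [if_neg hτ, zero_mul, zero_mul]

/-- The mirror splitting: kernel `c(q,r,q̄r)·g` with `c ≥ 0` and nonnegative inner free-block sums. [this work] -/
theorem ps_nonneg_of_innerI (c : Pd k → Pd k → Pd k → ℤ) (g : Pd n → Pd n → Pd n → Pd k → Pd k → ℤ)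
    (hc : ∀ q r, 0 ≤ c q r (thirdPt q r))
    (hg : ∀ q r, TotDist q r = true → 0 ≤ ∑ ξ : Pd n, ∑ η : Pd n, (if TotDist ξ η = true then (1:ℤ) else 0) * g ξ η (thirdPt ξ η) q r) :
    0 ≤ ∑ ξ : Pd n, ∑ η : Pd n, ∑ q : Pd k, ∑ r : Pd k,
      (if TotDist ξ η = true then (1:ℤ) else 0) * (if TotDist q r = true then (1:ℤ) else 0) * (c q r (thirdPt q r) * g ξ η (thirdPt ξ η) q r) := by
  have e : (∑ ξ : Pd n, ∑ η : Pd n, ∑ q : Pd k, ∑ r : Pd k,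
      (if TotDist ξ η = true then (1:ℤ) else 0) * (if TotDist q r = true then (1:ℤ) else 0) * (c q r (thirdPt q r) * g ξ η (thirdPt ξ η) q r))
      = ∑ q : Pd k, ∑ r : Pd k, ((if TotDist q r = true then (1:ℤ) else 0) * c q r (thirdPt q r)) *
          ∑ ξ : Pd n, ∑ η : Pd n, (if TotDist ξ η = true then (1:ℤ) else 0) * g ξ η (thirdPt ξ η) q r := by
    rw [sum_comm4 (fun ξ η q r => (if TotDist ξ η = true then (1:ℤ) else 0) * (if TotDist q r = true then (1:ℤ) else 0) *
      (c q r (thirdPt q r) * g ξ η (thirdPt ξ η) q r))]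
    refine Finset.sum_congr rfl fun q _ => Finset.sum_congr rfl fun r _ => ?_
    rw [Finset.mul_sum]
    refine Finset.sum_congr rfl fun ξ _ => ?_
    rw [Finset.mul_sum]
    refine Finset.sum_congr rfl fun η _ => ?_
    ring
  rw [e]
  refine Finset.sum_nonneg fun q _ => Finset.sum_nonneg fun r _ => ?_
  by_cases hτ : TotDist q r = true
  · rw [if_pos hτ, one_mul]; exact mul_nonneg (hc q r) (hg q r hτ)
  · rw [if_neg hτ, zero_mul, zero_mul]

/-! ### The theorem -/

set_option maxHeartbeats 8000000 in
/-- **THE TWO-ORTHANT THEOREM, (N)-form** (every `n, k`): for `a ∈ [3]^n` with a coordinate equal to `2` and any `b ∈ [3]^k`, with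
`X` free-measurable with trace `↑a` and `Y` cell-measurable with trace `↑b`, the hypothesis `hS` of `sStarD_cylSet_pairCert_nonneg_of_sStarD_ge`
holds: `Φ(A∩A') ≤ sStarD (X∪Y) A A'` for all up-sets `A, A'`. [this work] -/
theorem twoOrthant_hS_of_two {X Y : Finset (Pd (n + k))} (a : Pd n) (ha : ∃ i, a i = 2) (b : Pd k)
    (hX : ∀ ξ q, glue ξ q ∈ X ↔ ξ ∈ (univ.filter fun x : Pd n => ∀ i, a i ≤ x i))
    (hY : ∀ ξ q, glue ξ q ∈ Y ↔ q ∈ (univ.filter fun x : Pd k => ∀ j, b j ≤ x j)) :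
    ∀ A A' : Finset (Pd (n + k)), IsUpperSet (A : Set (Pd (n + k))) → IsUpperSet (A' : Set (Pd (n + k))) →
      2 ^ k * (∑ q : Pd k, (1 - ind (univ.filter fun x : Pd k => ∀ j, b j ≤ x j) q) *
          ∑ ξ : Pd n, ind (fibre (A ∩ A') q) ξ * (2 ^ n * ind (univ.filter fun x : Pd n => ∀ i, a i ≤ x i) ξ
            - (nuCount (univ.filter fun x : Pd n => ∀ i, a i ≤ x i) ξ : ℤ)))
        + (∑ ξ : Pd n, (1 - ind (univ.filter fun x : Pd n => ∀ i, a i ≤ x i) ξ)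
            * (2 ^ n - (nuCount (univ.filter fun x : Pd n => ∀ i, a i ≤ x i) ξ : ℤ))
            * ∑ q : Pd k, ind (sect (A ∩ A') ξ) q * (2 ^ k * ind (univ.filter fun x : Pd k => ∀ j, b j ≤ x j) q
              - (nuCount (univ.filter fun x : Pd k => ∀ j, b j ≤ x j) q : ℤ)))
        ≤ sStarD (X ∪ Y) A A' := by
  intro A A' hA hA'
  set XI : Finset (Pd n) := univ.filter fun x : Pd n => ∀ i, a i ≤ x i with hXI
  set YJ : Finset (Pd k) := univ.filter fun x : Pd k => ∀ j, b j ≤ x j with hYJ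
  have ha0 : ∃ i, a i ≠ 0 := by obtain ⟨i, hi⟩ := ha; exact ⟨i, by rw [hi]; decide⟩
  rw [← sub_nonneg, sStarD_union_sub_pairCertSlack_eq_pairSum hX hY A A']
  -- the two local kernels
  set κL : Pd n → Pd n → Pd n → Pd k → Pd k → Pd k → ℤ := (fun (ξ η ζ : Pd n) (q r w : Pd k) => (2 * (ind XI ξ + ind YJ q - ind XI ξ * ind YJ q) * ind A (glue ξ q) * ind A' (glue ξ q) - (ind XI ξ + ind YJ q - ind XI ξ * ind YJ q) * ind A (glue η r) * ind A' (glue η r) - ind A (glue ξ q) * (ind XI η + ind YJ r - ind XI η * ind YJ r) * ind A' (glue η r) - ind A' (glue ξ q) * (ind XI η + ind YJ r - ind XI η * ind YJ r) * ind A (glue η r) + ind A (glue ξ q) * ind A' (glue η r) * (ind XI ζ + ind YJ w - ind XI ζ * ind YJ w) - ind A (glue ξ q) * ind A' (glue ξ q) * ((1 - ind YJ q) * (ind XI ξ - ind XI η) + (1 - ind XI ξ) * (1 - ind XI η) * (ind YJ q - ind YJ r)))) with hκL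
  set κ1 : Pd n → Pd n → Pd n → Pd k → Pd k → Pd k → ℤ := (fun (ξ η ζ : Pd n) (q r w : Pd k) => (ind XI ξ * (1 - ind XI η)) * (ind A (glue ξ q) * (ind A' (glue η q) * ind YJ q - ind A' (glue η r) * ind YJ r))) with hκ1
  set κ2 : Pd n → Pd n → Pd n → Pd k → Pd k → Pd k → ℤ := (fun (ξ η ζ : Pd n) (q r w : Pd k) => (ind XI ξ * (1 - ind XI η)) * (ind A' (glue ξ q) * (ind A (glue η q) * ind YJ q - ind A (glue η r) * ind YJ r))) with hκ2
  set κ3 : Pd n → Pd n → Pd n → Pd k → Pd k → Pd k → ℤ := (fun (ξ η ζ : Pd n) (q r w : Pd k) => (ind XI ξ * (1 - ind XI η)) * ((1 - ind YJ q) * ind A (glue ξ r) * (ind A' (glue ξ r) - ind A' (glue ξ w)))) with hκ3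
  set κ4 : Pd n → Pd n → Pd n → Pd k → Pd k → Pd k → ℤ := (fun (ξ η ζ : Pd n) (q r w : Pd k) => (ind XI ξ * ind XI η) * (ind A (glue ξ q) * (ind A' (glue ξ q) - ind A' (glue ξ r)))) with hκ4
  set κ5 : Pd n → Pd n → Pd n → Pd k → Pd k → Pd k → ℤ := (fun (ξ η ζ : Pd n) (q r w : Pd k) => ((1 - ind XI ξ) * (1 - ind XI η)) * (ind A (glue ξ q) * ind A' (glue η q) * ind YJ q - ind A (glue ξ q) * ind A' (glue η r) * (ind YJ q + ind YJ r - ind YJ w))) with hκ5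
  set κ6 : Pd n → Pd n → Pd n → Pd k → Pd k → Pd k → ℤ := (fun (ξ η ζ : Pd n) (q r w : Pd k) => ind YJ q * ((1 - ind XI ξ * ind XI η) * (ind A' (glue ξ q) * (ind A (glue ξ q) - ind A (glue η q))))) with hκ6
  set κ7 : Pd n → Pd n → Pd n → Pd k → Pd k → Pd k → ℤ := (fun (ξ η ζ : Pd n) (q r w : Pd k) => (1 - ind YJ w) * ((ind XI ξ * ((1 - ind XI η) * (1 - ind XI ζ))) * ((ind A (glue ξ q) - ind A (glue η q)) * (ind A' (glue ξ r) - ind A' (glue ζ r))))) with hκ7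
  set κ8 : Pd n → Pd n → Pd n → Pd k → Pd k → Pd k → ℤ := (fun (ξ η ζ : Pd n) (q r w : Pd k) => (2 - ind YJ w) * ((ind XI ξ * ind XI η) * ((ind A (glue ξ q) - ind A (glue η q)) * ind A' (glue ξ r)))) with hκ8
  set κR : Pd n → Pd n → Pd n → Pd k → Pd k → Pd k → ℤ :=
    (fun (ξ η ζ : Pd n) (q r w : Pd k) => κ1 ξ η ζ q r w + κ2 ξ η ζ q r w + κ3 ξ η ζ q r w + κ4 ξ η ζ q r w
      + κ5 ξ η ζ q r w + κ6 ξ η ζ q r w + κ7 ξ η ζ q r w + κ8 ξ η ζ q r w) with hκR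
  -- the goal is `0 ≤ PS κL`
  show 0 ≤ (∑ ξ : Pd n, ∑ η : Pd n, ∑ q : Pd k, ∑ r : Pd k, (if TotDist ξ η = true then (1:ℤ) else 0) * (if TotDist q r = true then (1:ℤ) else 0) * (κL ξ η (thirdPt ξ η) q r (thirdPt q r)))
  -- symmetrisation: 36·PS(κ) = PS(sym36 κ)
  have hL6 := ps_symJ6 κL
  have hL36 := ps_symI6 (fun (ξ η ζ : Pd n) (q r w : Pd k) => κL ξ η ζ q r w + κL ξ η ζ r q w + κL ξ η ζ q w r + κL ξ η ζ r w q + κL ξ η ζ w q r + κL ξ η ζ w r q)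
  try dsimp only at hL36
  have hR6 := ps_symJ6 κR
  have hR36 := ps_symI6 (fun (ξ η ζ : Pd n) (q r w : Pd k) => κR ξ η ζ q r w + κR ξ η ζ r q w + κR ξ η ζ q w r + κR ξ η ζ r w q + κR ξ η ζ w q r + κR ξ η ζ w r q)
  try dsimp only at hR36
  -- the pointwise identity of the symmetrised kernels
  have hpt : (∑ ξ : Pd n, ∑ η : Pd n, ∑ q : Pd k, ∑ r : Pd k, (if TotDist ξ η = true then (1:ℤ) else 0) * (if TotDist q r = true then (1:ℤ) else 0) * ((κL ξ η (thirdPt ξ η) q r (thirdPt q r)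
            + κL ξ η (thirdPt ξ η) r q (thirdPt q r)
            + κL ξ η (thirdPt ξ η) q (thirdPt q r) r
            + κL ξ η (thirdPt ξ η) r (thirdPt q r) q
            + κL ξ η (thirdPt ξ η) (thirdPt q r) q r
            + κL ξ η (thirdPt ξ η) (thirdPt q r) r q)
          + (κL η ξ (thirdPt ξ η) q r (thirdPt q r)
            + κL η ξ (thirdPt ξ η) r q (thirdPt q r)
            + κL η ξ (thirdPt ξ η) q (thirdPt q r) r
            + κL η ξ (thirdPt ξ η) r (thirdPt q r) q
            + κL η ξ (thirdPt ξ η) (thirdPt q r) q r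
            + κL η ξ (thirdPt ξ η) (thirdPt q r) r q)
          + (κL ξ (thirdPt ξ η) η q r (thirdPt q r)
            + κL ξ (thirdPt ξ η) η r q (thirdPt q r)
            + κL ξ (thirdPt ξ η) η q (thirdPt q r) r
            + κL ξ (thirdPt ξ η) η r (thirdPt q r) q
            + κL ξ (thirdPt ξ η) η (thirdPt q r) q r
            + κL ξ (thirdPt ξ η) η (thirdPt q r) r q)
          + (κL η (thirdPt ξ η) ξ q r (thirdPt q r)
            + κL η (thirdPt ξ η) ξ r q (thirdPt q r)
            + κL η (thirdPt ξ η) ξ q (thirdPt q r) r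
            + κL η (thirdPt ξ η) ξ r (thirdPt q r) q
            + κL η (thirdPt ξ η) ξ (thirdPt q r) q r
            + κL η (thirdPt ξ η) ξ (thirdPt q r) r q)
          + (κL (thirdPt ξ η) ξ η q r (thirdPt q r)
            + κL (thirdPt ξ η) ξ η r q (thirdPt q r)
            + κL (thirdPt ξ η) ξ η q (thirdPt q r) r
            + κL (thirdPt ξ η) ξ η r (thirdPt q r) q
            + κL (thirdPt ξ η) ξ η (thirdPt q r) q r
            + κL (thirdPt ξ η) ξ η (thirdPt q r) r q)
          + (κL (thirdPt ξ η) η ξ q r (thirdPt q r)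
            + κL (thirdPt ξ η) η ξ r q (thirdPt q r)
            + κL (thirdPt ξ η) η ξ q (thirdPt q r) r
            + κL (thirdPt ξ η) η ξ r (thirdPt q r) q
            + κL (thirdPt ξ η) η ξ (thirdPt q r) q r
            + κL (thirdPt ξ η) η ξ (thirdPt q r) r q)))
      = (∑ ξ : Pd n, ∑ η : Pd n, ∑ q : Pd k, ∑ r : Pd k, (if TotDist ξ η = true then (1:ℤ) else 0) * (if TotDist q r = true then (1:ℤ) else 0) * ((κR ξ η (thirdPt ξ η) q r (thirdPt q r)
            + κR ξ η (thirdPt ξ η) r q (thirdPt q r)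
            + κR ξ η (thirdPt ξ η) q (thirdPt q r) r
            + κR ξ η (thirdPt ξ η) r (thirdPt q r) q
            + κR ξ η (thirdPt ξ η) (thirdPt q r) q r
            + κR ξ η (thirdPt ξ η) (thirdPt q r) r q)
          + (κR η ξ (thirdPt ξ η) q r (thirdPt q r)
            + κR η ξ (thirdPt ξ η) r q (thirdPt q r)
            + κR η ξ (thirdPt ξ η) q (thirdPt q r) r
            + κR η ξ (thirdPt ξ η) r (thirdPt q r) q
            + κR η ξ (thirdPt ξ η) (thirdPt q r) q r
            + κR η ξ (thirdPt ξ η) (thirdPt q r) r q)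
          + (κR ξ (thirdPt ξ η) η q r (thirdPt q r)
            + κR ξ (thirdPt ξ η) η r q (thirdPt q r)
            + κR ξ (thirdPt ξ η) η q (thirdPt q r) r
            + κR ξ (thirdPt ξ η) η r (thirdPt q r) q
            + κR ξ (thirdPt ξ η) η (thirdPt q r) q r
            + κR ξ (thirdPt ξ η) η (thirdPt q r) r q)
          + (κR η (thirdPt ξ η) ξ q r (thirdPt q r)
            + κR η (thirdPt ξ η) ξ r q (thirdPt q r)
            + κR η (thirdPt ξ η) ξ q (thirdPt q r) r
            + κR η (thirdPt ξ η) ξ r (thirdPt q r) q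
            + κR η (thirdPt ξ η) ξ (thirdPt q r) q r
            + κR η (thirdPt ξ η) ξ (thirdPt q r) r q)
          + (κR (thirdPt ξ η) ξ η q r (thirdPt q r)
            + κR (thirdPt ξ η) ξ η r q (thirdPt q r)
            + κR (thirdPt ξ η) ξ η q (thirdPt q r) r
            + κR (thirdPt ξ η) ξ η r (thirdPt q r) q
            + κR (thirdPt ξ η) ξ η (thirdPt q r) q r
            + κR (thirdPt ξ η) ξ η (thirdPt q r) r q)
          + (κR (thirdPt ξ η) η ξ q r (thirdPt q r)
            + κR (thirdPt ξ η) η ξ r q (thirdPt q r)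
            + κR (thirdPt ξ η) η ξ q (thirdPt q r) r
            + κR (thirdPt ξ η) η ξ r (thirdPt q r) q
            + κR (thirdPt ξ η) η ξ (thirdPt q r) q r
            + κR (thirdPt ξ η) η ξ (thirdPt q r) r q))) := by
    refine Finset.sum_congr rfl fun ξ _ => Finset.sum_congr rfl fun η _ => Finset.sum_congr rfl fun q _ => Finset.sum_congr rfl fun r _ => ?_
    by_cases hτ : TotDist ξ η = true
    · have hz := ind_orthant_latin_zero a ha0 hτ
      rw [← hXI] at hz
      simp only [hκL, hκR, hκ1, hκ2, hκ3, hκ4, hκ5, hκ6, hκ7, hκ8]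
      rcases hz with h | h | h <;> simp only [h] <;> ring
    · rw [if_neg hτ]; ring
  have key : 36 * (∑ ξ : Pd n, ∑ η : Pd n, ∑ q : Pd k, ∑ r : Pd k, (if TotDist ξ η = true then (1:ℤ) else 0) * (if TotDist q r = true then (1:ℤ) else 0) * (κL ξ η (thirdPt ξ η) q r (thirdPt q r)))
      = 36 * (∑ ξ : Pd n, ∑ η : Pd n, ∑ q : Pd k, ∑ r : Pd k, (if TotDist ξ η = true then (1:ℤ) else 0) * (if TotDist q r = true then (1:ℤ) else 0) * (κR ξ η (thirdPt ξ η) q r (thirdPt q r))) := by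
    have e1 : (36:ℤ) * (∑ ξ : Pd n, ∑ η : Pd n, ∑ q : Pd k, ∑ r : Pd k, (if TotDist ξ η = true then (1:ℤ) else 0) * (if TotDist q r = true then (1:ℤ) else 0) * (κL ξ η (thirdPt ξ η) q r (thirdPt q r))) = 6 * (6 * (∑ ξ : Pd n, ∑ η : Pd n, ∑ q : Pd k, ∑ r : Pd k, (if TotDist ξ η = true then (1:ℤ) else 0) * (if TotDist q r = true then (1:ℤ) else 0) * (κL ξ η (thirdPt ξ η) q r (thirdPt q r)))) := by ring
    have e2 : (36:ℤ) * (∑ ξ : Pd n, ∑ η : Pd n, ∑ q : Pd k, ∑ r : Pd k, (if TotDist ξ η = true then (1:ℤ) else 0) * (if TotDist q r = true then (1:ℤ) else 0) * (κR ξ η (thirdPt ξ η) q r (thirdPt q r))) = 6 * (6 * (∑ ξ : Pd n, ∑ η : Pd n, ∑ q : Pd k, ∑ r : Pd k, (if TotDist ξ η = true then (1:ℤ) else 0) * (if TotDist q r = true then (1:ℤ) else 0) * (κR ξ η (thirdPt ξ η) q r (thirdPt q r)))) := by ring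
    rw [e1, e2, ← hL6, ← hR6, ← hL36, ← hR36]
    exact hpt
  have hRnonneg : 0 ≤ (∑ ξ : Pd n, ∑ η : Pd n, ∑ q : Pd k, ∑ r : Pd k, (if TotDist ξ η = true then (1:ℤ) else 0) * (if TotDist q r = true then (1:ℤ) else 0) * (κR ξ η (thirdPt ξ η) q r (thirdPt q r))) := by
    simp only [hκR, mul_add, Finset.sum_add_distrib]
    have hsecA : ∀ ξ : Pd n, IsUpperSet ((sect A ξ : Finset (Pd k)) : Set (Pd k)) := fun ξ => isUpperSet_sect hA ξ
    have hsecA' : ∀ ξ : Pd n, IsUpperSet ((sect A' ξ : Finset (Pd k)) : Set (Pd k)) := fun ξ => isUpperSet_sect hA' ξ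
    have hfibA : ∀ q : Pd k, IsUpperSet ((fibre A q : Finset (Pd n)) : Set (Pd n)) := fun q => isUpperSet_fibre hA q
    have hfibA' : ∀ q : Pd k, IsUpperSet ((fibre A' q : Finset (Pd n)) : Set (Pd n)) := fun q => isUpperSet_fibre hA' q
    have hYJup : IsUpperSet (YJ : Set (Pd k)) := by rw [hYJ]; exact isUpperSet_filter_le b
    have i01 : ∀ (S : Finset (Pd n)) (x : Pd n), 0 ≤ ind S x ∧ ind S x ≤ 1 := fun S x => ⟨ind_nonneg' S x, ind_le_one' S x⟩
    have j01 : ∀ (S : Finset (Pd k)) (x : Pd k), 0 ≤ ind S x ∧ ind S x ≤ 1 := fun S x => ⟨ind_nonneg' S x, ind_le_one' S x⟩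
    -- family 1: Harris(A_ξ, A'_η ∩ Y)
    have f1 : 0 ≤ (∑ ξ : Pd n, ∑ η : Pd n, ∑ q : Pd k, ∑ r : Pd k, (if TotDist ξ η = true then (1:ℤ) else 0) * (if TotDist q r = true then (1:ℤ) else 0) * (κ1 ξ η (thirdPt ξ η) q r (thirdPt q r))) := by
      simp only [hκ1]
      refine ps_nonneg_of_innerJ (fun ξ η => ind XI ξ * (1 - ind XI η))
        (fun ξ η q r w => ind A (glue ξ q) * (ind A' (glue η q) * ind YJ q - ind A' (glue η r) * ind YJ r)) ?_ ?_
      · intro ξ η; nlinarith [i01 XI ξ, i01 XI η]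
      · intro ξ η _
        have h := pairKernel_harris_nonneg (sect A ξ) (sect A' η ∩ YJ) (hsecA ξ) (isUpperSet_inter_coe (hsecA' η) hYJup)
        simp only [ind_inter_eq_mul, ind_sect] at h
        exact h
    -- family 2: Harris(A'_ξ, A_η ∩ Y)
    have f2 : 0 ≤ (∑ ξ : Pd n, ∑ η : Pd n, ∑ q : Pd k, ∑ r : Pd k, (if TotDist ξ η = true then (1:ℤ) else 0) * (if TotDist q r = true then (1:ℤ) else 0) * (κ2 ξ η (thirdPt ξ η) q r (thirdPt q r))) := by
      simp only [hκ2]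
      refine ps_nonneg_of_innerJ (fun ξ η => ind XI ξ * (1 - ind XI η))
        (fun ξ η q r w => ind A' (glue ξ q) * (ind A (glue η q) * ind YJ q - ind A (glue η r) * ind YJ r)) ?_ ?_
      · intro ξ η; nlinarith [i01 XI ξ, i01 XI η]
      · intro ξ η _
        have h := pairKernel_harris_nonneg (sect A' ξ) (sect A η ∩ YJ) (hsecA' ξ) (isUpperSet_inter_coe (hsecA η) hYJup)
        simp only [ind_inter_eq_mul, ind_sect] at h
        exact h
    -- family 3: Kleitman(Ȳ; A_ξ, A'_ξ)
    have f3 : 0 ≤ (∑ ξ : Pd n, ∑ η : Pd n, ∑ q : Pd k, ∑ r : Pd k, (if TotDist ξ η = true then (1:ℤ) else 0) * (if TotDist q r = true then (1:ℤ) else 0) * (κ3 ξ η (thirdPt ξ η) q r (thirdPt q r))) := by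
      simp only [hκ3]
      refine ps_nonneg_of_innerJ (fun ξ η => ind XI ξ * (1 - ind XI η))
        (fun ξ η q r w => (1 - ind YJ q) * ind A (glue ξ r) * (ind A' (glue ξ r) - ind A' (glue ξ w))) ?_ ?_
      · intro ξ η; nlinarith [i01 XI ξ, i01 XI η]
      · intro ξ η _
        have h := pairKernel_kleitman_nonneg (univ \ YJ) (sect A ξ) (sect A' ξ) (hsecA ξ) (hsecA' ξ)
        simp only [ind_sdiff_univ, ind_sect] at h
        exact h
    -- family 4: Harris(A_ξ, A'_ξ)
    have f4 : 0 ≤ (∑ ξ : Pd n, ∑ η : Pd n, ∑ q : Pd k, ∑ r : Pd k, (if TotDist ξ η = true then (1:ℤ) else 0) * (if TotDist q r = true then (1:ℤ) else 0) * (κ4 ξ η (thirdPt ξ η) q r (thirdPt q r))) := by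
      simp only [hκ4]
      refine ps_nonneg_of_innerJ (fun ξ η => ind XI ξ * ind XI η)
        (fun ξ η q r w => ind A (glue ξ q) * (ind A' (glue ξ q) - ind A' (glue ξ r))) ?_ ?_
      · intro ξ η; nlinarith [i01 XI ξ, i01 XI η]
      · intro ξ η _
        have h := pairKernel_harris_nonneg (sect A ξ) (sect A' ξ) (hsecA ξ) (hsecA' ξ)
        simp only [ind_sect] at h
        exact h
    -- family 5: Conjecture P for the orthant `YJ` (Θ-form)
    have f5 : 0 ≤ (∑ ξ : Pd n, ∑ η : Pd n, ∑ q : Pd k, ∑ r : Pd k, (if TotDist ξ η = true then (1:ℤ) else 0) * (if TotDist q r = true then (1:ℤ) else 0) * (κ5 ξ η (thirdPt ξ η) q r (thirdPt q r))) := by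
      simp only [hκ5]
      refine ps_nonneg_of_innerJ (fun ξ η => (1 - ind XI ξ) * (1 - ind XI η))
        (fun ξ η q r w => ind A (glue ξ q) * ind A' (glue η q) * ind YJ q
          - ind A (glue ξ q) * ind A' (glue η r) * (ind YJ q + ind YJ r - ind YJ w)) ?_ ?_
      · intro ξ η; nlinarith [i01 XI ξ, i01 XI η]
      · intro ξ η _
        have h := pairKernel_conjP_theta_nonneg b (sect A ξ) (sect A' η) (hsecA ξ) (hsecA' η)
        rw [← hYJ] at h
        simp only [ind_sect] at h
        exact h
    -- family 6: coefficientwise Harris of the fibres (Q_D; no pairs inside `↑a` since `a` has a `2`)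
    have f6 : 0 ≤ (∑ ξ : Pd n, ∑ η : Pd n, ∑ q : Pd k, ∑ r : Pd k, (if TotDist ξ η = true then (1:ℤ) else 0) * (if TotDist q r = true then (1:ℤ) else 0) * (κ6 ξ η (thirdPt ξ η) q r (thirdPt q r))) := by
      simp only [hκ6]
      refine ps_nonneg_of_innerI (fun q r w => ind YJ q)
        (fun ξ η ζ q r => (1 - ind XI ξ * ind XI η) * (ind A' (glue ξ q) * (ind A (glue ξ q) - ind A (glue η q)))) ?_ ?_
      · intro q r; exact (j01 YJ q).1
      · intro q r _
        have h := pairKernel_harris_nonneg (fibre A' q) (fibre A q) (hfibA' q) (hfibA q)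
        simp only [ind_fibre] at h
        have e : (∑ ξ : Pd n, ∑ η : Pd n, (if TotDist ξ η = true then (1:ℤ) else 0) *
            ((1 - ind XI ξ * ind XI η) * (ind A' (glue ξ q) * (ind A (glue ξ q) - ind A (glue η q)))))
            = ∑ ξ : Pd n, ∑ η : Pd n, (if TotDist ξ η = true then (1:ℤ) else 0) *
              (ind A' (glue ξ q) * (ind A (glue ξ q) - ind A (glue η q))) := by
          refine Finset.sum_congr rfl fun ξ _ => Finset.sum_congr rfl fun η _ => ?_
          by_cases hτ : TotDist ξ η = true
          · have hz := ind_orthant_mul_eq_zero_of_two a ha hτ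
            rw [← hXI] at hz
            rw [show (1 - ind XI ξ * ind XI η) = 1 by rw [hz]; ring, one_mul]
          · rw [if_neg hτ]; ring
        rw [e]; exact h
    -- family 7: Conjecture P for the orthant `XI` (witness form; Q_E)
    have f7 : 0 ≤ (∑ ξ : Pd n, ∑ η : Pd n, ∑ q : Pd k, ∑ r : Pd k, (if TotDist ξ η = true then (1:ℤ) else 0) * (if TotDist q r = true then (1:ℤ) else 0) * (κ7 ξ η (thirdPt ξ η) q r (thirdPt q r))) := by
      simp only [hκ7]
      refine ps_nonneg_of_innerI (fun q r w => 1 - ind YJ w)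
        (fun ξ η ζ q r => (ind XI ξ * ((1 - ind XI η) * (1 - ind XI ζ))) * ((ind A (glue ξ q) - ind A (glue η q)) * (ind A' (glue ξ r) - ind A' (glue ζ r)))) ?_ ?_
      · intro q r; nlinarith [j01 YJ (thirdPt q r)]
      · intro q r _
        have h := pairKernel_conjP_witness_nonneg a (fibre A q) (fibre A' r) (hfibA q) (hfibA' r)
        rw [← hXI] at h
        simp only [ind_fibre] at h
        have e : (∑ ξ : Pd n, ∑ η : Pd n, (if TotDist ξ η = true then (1:ℤ) else 0) *
            ((ind XI ξ * ((1 - ind XI η) * (1 - ind XI (thirdPt ξ η)))) * ((ind A (glue ξ q) - ind A (glue η q)) * (ind A' (glue ξ r) - ind A' (glue (thirdPt ξ η) r)))))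
            = ∑ ξ : Pd n, ∑ η : Pd n, (if TotDist ξ η = true then (1:ℤ) else 0) *
              (ind XI ξ * (ind A (glue ξ q) - ind A (glue η q)) * (ind A' (glue ξ r) - ind A' (glue (thirdPt ξ η) r))) := by
          refine Finset.sum_congr rfl fun ξ _ => Finset.sum_congr rfl fun η _ => ?_
          by_cases hτ : TotDist ξ η = true
          · have hz1 := ind_orthant_mul_eq_zero_of_two a ha hτ
            have hz2 := ind_orthant_mul_third_eq_zero_of_two a ha hτ
            rw [← hXI] at hz1 hz2
            have ee : ind XI ξ * ((1 - ind XI η) * (1 - ind XI (thirdPt ξ η))) = ind XI ξ := by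
              have : ind XI ξ * ((1 - ind XI η) * (1 - ind XI (thirdPt ξ η)))
                  = ind XI ξ - ind XI ξ * ind XI η - ind XI ξ * ind XI (thirdPt ξ η) + (ind XI ξ * ind XI η) * ind XI (thirdPt ξ η) := by ring
              rw [this, hz1, hz2]; ring
            rw [ee]; ring
          · rw [if_neg hτ]; ring
        rw [e]; exact h
    -- family 8: vanishes (no totally distinct pairs inside `↑a`)
    have f8 : 0 ≤ (∑ ξ : Pd n, ∑ η : Pd n, ∑ q : Pd k, ∑ r : Pd k, (if TotDist ξ η = true then (1:ℤ) else 0) * (if TotDist q r = true then (1:ℤ) else 0) * (κ8 ξ η (thirdPt ξ η) q r (thirdPt q r))) := by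
      simp only [hκ8]
      refine Finset.sum_nonneg fun ξ _ => Finset.sum_nonneg fun η _ => Finset.sum_nonneg fun q _ => Finset.sum_nonneg fun r _ => ?_
      by_cases hτ : TotDist ξ η = true
      · have hz := ind_orthant_mul_eq_zero_of_two a ha hτ
        rw [← hXI] at hz
        rw [hz]; simp
      · rw [if_neg hτ]; simp
    linarith [f1, f2, f3, f4, f5, f6, f7, f8]
  linarith [key, hRnonneg]

/-- **THE TWO-ORTHANT THEOREM** (every dimension): for `a ∈ [3]^n` with a coordinate equal to `2`, any `b ∈ [3]^k`, the union
`U = ↑a × [3]^k ∪ [3]^n × ↑b` of the two orthants is a good slot of the pattern functional in every dimension: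
`0 ≤ sStarD (U × [3]^m) B C` for all `m` and all up-sets `B, C ⊆ [3]^{m+(n+k)}`. [this work] -/
theorem sStarD_cylSet_twoOrthant_nonneg_of_two {m : ℕ} (a : Pd n) (ha : ∃ i, a i = 2) (b : Pd k)
    {B C : Finset (Pd (m + (n + k)))} (hB : IsUpperSet (B : Set (Pd (m + (n + k))))) (hC : IsUpperSet (C : Set (Pd (m + (n + k))))) :
    0 ≤ sStarD (cylSet ((univ.filter fun x : Pd (n + k) => ∀ i, a i ≤ x (Fin.castAdd k i))
        ∪ (univ.filter fun x : Pd (n + k) => ∀ j, b j ≤ x (Fin.natAdd n j))) : Finset (Pd (m + (n + k)))) B C := by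
  have hX : ∀ (ξ : Pd n) (q : Pd k), glue ξ q ∈ (univ.filter fun x : Pd (n + k) => ∀ i, a i ≤ x (Fin.castAdd k i))
      ↔ ξ ∈ (univ.filter fun x : Pd n => ∀ i, a i ≤ x i) := by
    intro ξ q; simp only [Finset.mem_filter, Finset.mem_univ, true_and, glue_castAdd]
  have hY : ∀ (ξ : Pd n) (q : Pd k), glue ξ q ∈ (univ.filter fun x : Pd (n + k) => ∀ j, b j ≤ x (Fin.natAdd n j))
      ↔ q ∈ (univ.filter fun x : Pd k => ∀ j, b j ≤ x j) := by
    intro ξ q; simp only [Finset.mem_filter, Finset.mem_univ, true_and, glue_natAdd]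
  exact sStarD_cylSet_pairCert_nonneg_of_sStarD_ge hX hY (isUpperSet_filter_le a) (isUpperSet_filter_le b)
    (twoOrthant_hS_of_two a ha b hX hY) hB hC

end Summit.CriticalPhenomena.PercolationContinuityZ3.Theorems.SahiGridPattern
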